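import Summits.QuantumFields.YangMills.Theorems.FluctuationComparisonRegPrIntLS1aAlphaMemOfRunOfAlpha
import Literature.MathematicalPhysics.QuantumFieldTheory.Balaban1983to89.B12ContinuousTransportInvariance
import HarnessLib

/-!
# S1a · UV3-NODE §69.15 — THE CUT-HEIGHT TRANSFER (§67.3 (m3)) AS A DOOR: Bałaban-class membership is INHERITED by a dominated density up to a window-dominance
# factor (`slack ↦ slack + Δ`); the cut tower of S1aᴴ is dominated by the uncut run (any density cuts `≤ 1`), continuous versions ordered EVERYWHERE; so (m) at a cut height
# follows from (m) for the uncut run at the same height plus ONE displayed letter — conditional small-field dominance `ρ^{true}_j ≤ e^{Δ_j}·ρ^{cut}_j` on the window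

Cell `ym3-torus` (YM ladder rung R3 = continuum `SU(2)` Yang–Mills on the three-torus — a RUNG: NOT d = 4, NOT infinite volume, NOT a mass gap, NOT Clay).
Width seat «width 8» `ym3-torus-px8` (gen 24), FREE px helper on crux `stmt-QuantumFields-20520`, count-neutral, DEFINITION-FREE, default heartbeats.

WHY.  UV3-NODE §67.3 (m3) (px20 g20): below the switching height `Ts` the line's measures are the CUT tower `μ j = (descend)_*(μ (j+1)·sfCut θ_{j+1})`, NOT `ν K j`; its density is
dominated by the uncut one (`sfCut ≤ 1`), so the class's `upper`, `lf_le`, `large` clauses TRANSFER by monotonicity, while `lower` ((47)) does not — it needs (47) for the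
`Π sfCut`-restricted fibre integral.  This file types the transfer once and for all, in `BalabanUVClass.Mem`'s own letters, and isolates what does not transfer as ONE
hypothesis in ratio form.

WHAT (0 `def`, 0 `sorry`; nothing of Bałaban's asserted).
§1 ★★ `mem_of_dominated` (any `Params`, group, averaging family): `Mem av prm r`, `r′` measurable, gauge-invariant, `0 ≤ r′ ≤ r`, and `r ≤ e^Δ·r′` on the `prm.δ`-window (`Δ ≥ 0`)
   ⟹ `Mem av {prm with slack := prm.slack + Δ} r′` (same witness data: background, domains, activities, constant, large-field part).
§2 `gaugeInvariant_of_continuous_of_ae` — a continuous function a.e. invariant under every gauge transformation is gauge invariant (product Haar charges open sets);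
   `le_of_ae_le_of_continuous` — a.e. `≤` between continuous functions is everywhere `≤`.
§3 ★ `cutTower_le_run` — for S1aᴴ's run system `ν` and ANY tower `μ` with `μ j = ν K j` (`j ≥ Ts`) and `μ j = (descend F ℰp j)_*(μ (j+1)·(ofReal ∘ χ (j+1)))` (`j < Ts`) with
   density cuts `0 ≤ χ ≤ 1` (the line's `sfCut` is one such): `μ j ≤ ν K j` for every `j ≤ K`; ★ `density_le_of_cutTower` — continuous densities `ρᶜ` of `μ j` and `ρᵗ ≥ 0` of `ν K j`
   satisfy `ρᶜ ≤ ρᵗ` EVERYWHERE.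
§4 ★★★ `mem_cut_of_mem_run` — at a cut height: `Mem av prm (e^κ·ρᵗ)` (the uncut membership, e.g. from ✓p827768∕✓p827366), `ρᶜ` continuous ≥ 0 and a.e. gauge invariant,
   `μ j = dU·ρᶜ ≤ ν K j = dU·ρᵗ`, and THE LETTER `hdom : ∀ V, PlaqSmall prm.δ V → ρᵗ V ≤ e^Δ·ρᶜ V` ⟹ `Mem av {prm with slack := prm.slack + Δ} (e^κ·ρᶜ)`.
§5 `geom_add_le`, ★★ `admissible_add_slack` — if `prm` is admissible and `0 ≤ Δ_j ≤ S₁q₁^j` (`q₁ < 1`), `j ↦ {prm j with slack := slack_j + Δ_j}` is admissible (common ratio `max q q₁`).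
WHAT THIS FILE IS NOT: the letter `hdom` (§67.3 (m3)'s content: conditional small-field dominance of the cut fibre integral on the window — print's (47) derivation with every level's
`χ_i` inside `{sfCut = 1}`, window nesting `b ≤ b₀∕2`); the numerics `Δ_j ≤ S₁·q₁^j` of the letter (a supplier's); nothing of Bałaban's asserted or proved; 20520 ∕
`YM3TorusSU2` NOT proved; rung R3 — NOT d = 4, NOT infinite volume, NOT a mass gap, NOT Clay.  Sorry-free, axioms standard.
-/

set_option autoImplicit false

noncomputable section

namespace Summit.QuantumFields.YangMills.Theorems.FluctuationComparisonRegPrIntLS1aMemOfDominated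

open MeasureTheory Set
open scoped ENNReal
open Literature.MathematicalPhysics.QuantumFieldTheory.Balaban1983to89
open T3ContinuumYM3Torus T3UnitScaleTilt T3UnitLawDensityEML BalabanUVClass
open T3NestedUnitLaws (descend)
open Summit.QuantumFields.YangMills.Theorems.FluctuationComparisonRegPrIntLS1aInvariantVersion (le_on_of_ae_le_of_continuousOn)

/-! ## §1 Class membership is inherited by a dominated density up to a window-dominance factor -/

section Dominated

variable {P : Params} {k : ℕ} {G : Type*} [GaugeGroup G] [MeasurableSpace G]

/-- ★★ **MEMBERSHIP OF A DOMINATED DENSITY**: if `r ∈ 𝒞(prm)` and `0 ≤ r′ ≤ r` is measurable and gauge invariant with `r ≤ e^Δ·r′` on the all-small window (`Δ ≥ 0`), then `r′ ∈ 𝒞(prm′)`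
with `prm′ := {prm with slack := slack + Δ}` — the SAME background, localisation domains, activities, constant and large-field part witness it: `upper`∕`lf_le`∕`large` by
monotonicity, `lower` by the window dominance. [cite: Balaban1985UV3, (41)-(47) pp.266-267] -/
theorem mem_of_dominated {av : (i : ℕ) → Averaging P i G} {prm : ClassParams} {r r' : GaugeField P k G → ℝ} (h : Mem av prm r)
    (hm : Measurable r') (hgi : GaugeField.GaugeInvariant r') (h0 : ∀ V, 0 ≤ r' V) (hle : ∀ V, r' V ≤ r V)
    {Δ : ℝ} (hΔ : 0 ≤ Δ) (hdom : ∀ V, PlaqSmall prm.δ V → r V ≤ Real.exp Δ * r' V) :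
    Mem av { prm with slack := prm.slack + Δ } r' := by
  obtain ⟨W⟩ := h
  -- the two re-proved clauses
  have hlower : ∀ V, PlaqSmall prm.δ V →
      Real.exp (-(prm.β * wilsonAction4 (W.bg V)) + (∑ X, W.act X (W.bg V)) + W.cst - (prm.slack + Δ)) ≤ r' V := by
    intro V hV
    have h1 := W.lower V hV
    have h2 := hdom V hV
    have hsplit : Real.exp (-(prm.β * wilsonAction4 (W.bg V)) + (∑ X, W.act X (W.bg V)) + W.cst - (prm.slack + Δ)) =
        Real.exp (-Δ) * Real.exp (-(prm.β * wilsonAction4 (W.bg V)) + (∑ X, W.act X (W.bg V)) + W.cst - prm.slack) := by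
      rw [← Real.exp_add]; congr 1; ring
    rw [hsplit]
    calc Real.exp (-Δ) * Real.exp (-(prm.β * wilsonAction4 (W.bg V)) + (∑ X, W.act X (W.bg V)) + W.cst - prm.slack)
        ≤ Real.exp (-Δ) * r V := mul_le_mul_of_nonneg_left h1 (Real.exp_nonneg _)
      _ ≤ Real.exp (-Δ) * (Real.exp Δ * r' V) := mul_le_mul_of_nonneg_left h2 (Real.exp_nonneg _)
      _ = r' V := by rw [← mul_assoc, ← Real.exp_add, neg_add_cancel, Real.exp_zero, one_mul]
  have hupper : ∀ V, PlaqSmall prm.δ V →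
      r' V ≤ Real.exp (-(prm.β * wilsonAction4 (W.bg V)) + (∑ X, W.act X (W.bg V)) + W.cst + (prm.slack + Δ)) + W.lf V := by
    intro V hV
    refine (hle V).trans ((W.upper V hV).trans ?_)
    gcongr
    linarith
  exact ⟨
    { bg := W.bg
      nDom := W.nDom
      supp := W.supp
      foot := W.foot
      len := W.len
      wt := W.wt
      act := W.act
      cst := W.cst
      lf := W.lf
      nonneg := h0
      measurable := hm
      gaugeInvariant := hgi
      isBackground := W.isBackground
      foot_nonempty := W.foot_nonempty
      supp_foot := W.supp_foot
      len_nonneg := W.len_nonneg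
      wt_nonneg := W.wt_nonneg
      diam_foot := W.diam_foot
      act_local := W.act_local
      act_gaugeInvariant := W.act_gaugeInvariant
      act_bound := W.act_bound
      cover := W.cover
      cst_abs_le := W.cst_abs_le
      lower := hlower
      upper := hupper
      lf_nonneg := W.lf_nonneg
      lf_le := W.lf_le
      large := fun V S hS => (hle V).trans (W.large V S hS) }⟩

end Dominated

/-! ## §2 A.e. facts read everywhere for continuous functions on the configuration torus -/

section Continuous

variable {P : Params} {j : ℕ}

/-- A continuous function on the `SU(2)` configuration torus that is a.e. invariant under EVERY gauge transformation IS gauge invariant (both sides continuous, product Haar charges open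
sets). [cite: Balaban1985Averaging, (12)-(13) p.19] -/
theorem gaugeInvariant_of_continuous_of_ae {ρ : GaugeField P j (Matrix.specialUnitaryGroup (Fin 2) ℂ) → ℝ} (hc : Continuous ρ)
    (hae : ∀ g : Site P j → Matrix.specialUnitaryGroup (Fin 2) ℂ,
      (fun V => ρ (GaugeField.gaugeAct g V)) =ᵐ[fieldMeasure P j (Matrix.specialUnitaryGroup (Fin 2) ℂ)] ρ) :
    GaugeField.GaugeInvariant ρ := by
  haveI : (fieldMeasure P j (Matrix.specialUnitaryGroup (Fin 2) ℂ)).IsOpenPosMeasure :=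
    B12ContinuousTransportInvariance.isOpenPosMeasure_fieldMeasure_SU 2 P j
  haveI : BorelSpace (GaugeField P j (Matrix.specialUnitaryGroup (Fin 2) ℂ)) := T3OrbitAverage.instBorelSpaceGaugeField
  intro g V
  have hcg : Continuous fun V => ρ (GaugeField.gaugeAct g V) := hc.comp (T3OrbitAverage.continuous_gaugeAct (N := 2) g)
  exact congrFun ((Continuous.ae_eq_iff_eq (fieldMeasure P j (Matrix.specialUnitaryGroup (Fin 2) ℂ)) hcg hc).1 (hae g)) V

/-- A.e. `≤` between continuous functions on the configuration torus holds everywhere. [folklore] -/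
theorem le_of_ae_le_of_continuous {f g : GaugeField P j (Matrix.specialUnitaryGroup (Fin 2) ℂ) → ℝ} (hf : Continuous f) (hg : Continuous g)
    (h : ∀ᵐ V ∂fieldMeasure P j (Matrix.specialUnitaryGroup (Fin 2) ℂ), f V ≤ g V) : ∀ V, f V ≤ g V := by
  haveI : (fieldMeasure P j (Matrix.specialUnitaryGroup (Fin 2) ℂ)).IsOpenPosMeasure :=
    B12ContinuousTransportInvariance.isOpenPosMeasure_fieldMeasure_SU 2 P j
  haveI : BorelSpace (GaugeField P j (Matrix.specialUnitaryGroup (Fin 2) ℂ)) := T3OrbitAverage.instBorelSpaceGaugeField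
  intro V
  exact le_on_of_ae_le_of_continuousOn (μ := fieldMeasure P j (Matrix.specialUnitaryGroup (Fin 2) ℂ)) isOpen_univ hf.continuousOn hg.continuousOn
    (by rw [Measure.restrict_univ]; exact h) V (mem_univ V)

/-- Densities read everywhere: `dU·(ofReal ∘ ρᶜ) ≤ dU·(ofReal ∘ ρᵗ)` with `ρᶜ, ρᵗ` continuous and `ρᵗ ≥ 0` gives `ρᶜ ≤ ρᵗ` at every point. [folklore] -/
theorem density_le_of_withDensity_le {ρc ρt : GaugeField P j (Matrix.specialUnitaryGroup (Fin 2) ℂ) → ℝ} (hcc : Continuous ρc) (htc : Continuous ρt)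
    (ht0 : ∀ V, 0 ≤ ρt V)
    (hle : (fieldMeasure P j (Matrix.specialUnitaryGroup (Fin 2) ℂ)).withDensity (fun V => ENNReal.ofReal (ρc V)) ≤
      (fieldMeasure P j (Matrix.specialUnitaryGroup (Fin 2) ℂ)).withDensity (fun V => ENNReal.ofReal (ρt V))) :
    ∀ V, ρc V ≤ ρt V := by
  haveI : IsProbabilityMeasure (fieldMeasure P j (Matrix.specialUnitaryGroup (Fin 2) ℂ)) := Missing.isProbabilityMeasure_fieldMeasure P j
  haveI : BorelSpace (GaugeField P j (Matrix.specialUnitaryGroup (Fin 2) ℂ)) := T3OrbitAverage.instBorelSpaceGaugeField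
  have hcm : Measurable fun V => ENNReal.ofReal (ρc V) := ENNReal.measurable_ofReal.comp hcc.measurable
  have htm : Measurable fun V => ENNReal.ofReal (ρt V) := ENNReal.measurable_ofReal.comp htc.measurable
  have hae : ∀ᵐ V ∂fieldMeasure P j (Matrix.specialUnitaryGroup (Fin 2) ℂ), ENNReal.ofReal (ρc V) ≤ ENNReal.ofReal (ρt V) := by
    refine ae_le_of_forall_setLIntegral_le_of_sigmaFinite hcm fun s hs _ => ?_
    rw [← withDensity_apply _ hs, ← withDensity_apply _ hs]
    exact hle s
  refine le_of_ae_le_of_continuous hcc htc ?_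
  filter_upwards [hae] with V hV
  by_cases hc0 : 0 ≤ ρc V
  · exact (ENNReal.ofReal_le_ofReal_iff (ht0 V)).1 hV
  · exact (lt_of_not_ge hc0).le.trans (ht0 V)

end Continuous

/-! ## §3 The cut tower is dominated by the uncut run -/

section Tower

variable (F : T3Family) {γ : ℝ}

/-- ★ **THE CUT TOWER IS DOMINATED BY THE RUN**: for the run system `ν` of S1aᴴ and any tower `μ` agreeing with `ν K` from `Ts` up and cut below `Ts` by density weights `0 ≤ χ ≤ 1`
(`μ j = (descend F ℰp j)_*(μ (j+1)·(ofReal ∘ χ (j+1)))`), one has `μ j ≤ ν K j` at every height `j ≤ K`. [cite: Balaban1985UV3, (41) p.266 (every restriction only removes mass)] -/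
theorem cutTower_le_run (ν : ℕ → (j : ℕ) → Measure (GaugeField (F.P j) 0 (Matrix.specialUnitaryGroup (Fin 2) ℂ)))
    (hν2 : ∀ K j, j < K → ν K j = Measure.map (descend F ℰp j) (ν K (j + 1)))
    {K Ts : ℕ} (hTs : Ts ≤ K) (μ : (j : ℕ) → Measure (GaugeField (F.P j) 0 (Matrix.specialUnitaryGroup (Fin 2) ℂ)))
    (χ : (j : ℕ) → GaugeField (F.P j) 0 (Matrix.specialUnitaryGroup (Fin 2) ℂ) → ℝ) (hχ1 : ∀ j U, χ j U ≤ 1)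
    (hμ1 : ∀ j, Ts ≤ j → μ j = ν K j)
    (hμ2 : ∀ j, j < Ts → μ j = Measure.map (descend F ℰp j) ((μ (j + 1)).withDensity fun U => ENNReal.ofReal (χ (j + 1) U))) :
    ∀ j, j ≤ K → μ j ≤ ν K j := by
  -- downward induction on `j` from `Ts`
  suffices h : ∀ d j, j + d = Ts → μ j ≤ ν K j by
    intro j hj
    by_cases hjT : Ts ≤ j
    · exact (hμ1 j hjT).le
    · exact h (Ts - j) j (by omega)
  intro d
  induction d with
  | zero => intro j hj; exact (hμ1 j (by omega)).le
  | succ d ih =>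
      intro j hj
      have hjT : j < Ts := by omega
      have hjK : j < K := lt_of_lt_of_le hjT hTs
      have hstep := ih (j + 1) (by omega)
      rw [hμ2 j hjT, hν2 K j hjK]
      have hD : Measurable (descend F ℰp j : GaugeField (F.P (j + 1)) 0 (Matrix.specialUnitaryGroup (Fin 2) ℂ) → _) :=
        T3NestedUnitLaws.measurable_descend F ℰp T3UnitLawDensityEML.measurableE_ℰp j
      refine (Measure.map_mono ?_ hD)
      calc (μ (j + 1)).withDensity (fun U => ENNReal.ofReal (χ (j + 1) U))
          ≤ (μ (j + 1)).withDensity (fun _ => 1) := withDensity_mono (Filter.Eventually.of_forall fun U => by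
              simpa using ENNReal.ofReal_le_ofReal (hχ1 (j + 1) U))
        _ = μ (j + 1) := withDensity_one
        _ ≤ ν K (j + 1) := hstep

end Tower

/-! ## §4 (m) at a cut height from (m) for the run at the same height, plus ONE letter -/

section Cut

variable {P : Params} {j : ℕ}

/-- ★★★ **THE CUT-HEIGHT TRANSFER**: at a height where the cut tower's continuous density `ρᶜ ≥ 0` (a.e. gauge invariant) is dominated by the run's continuous density `ρᵗ ≥ 0`
(`dU·ρᶜ ≤ dU·ρᵗ`, e.g. ✓`cutTower_le_run`), class membership of `e^κ·ρᵗ` (the (α)-node, ✓p827768) and THE LETTER `ρᵗ ≤ e^Δ·ρᶜ` on the all-small window give class membership of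
`e^κ·ρᶜ` with the slack enlarged by `Δ`. [cite: Balaban1985UV3, (41)-(47) pp.266-267] -/
theorem mem_cut_of_mem_run {av : (i : ℕ) → Averaging P i (Matrix.specialUnitaryGroup (Fin 2) ℂ)} {prm : ClassParams} {κ Δ : ℝ} (hΔ : 0 ≤ Δ)
    {ρc ρt : GaugeField P j (Matrix.specialUnitaryGroup (Fin 2) ℂ) → ℝ} (hmem : Mem av prm (fun V => Real.exp κ * ρt V))
    (hcc : Continuous ρc) (htc : Continuous ρt) (hc0 : ∀ V, 0 ≤ ρc V) (ht0 : ∀ V, 0 ≤ ρt V)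
    (hcinv : ∀ g : Site P j → Matrix.specialUnitaryGroup (Fin 2) ℂ,
      (fun V => ρc (GaugeField.gaugeAct g V)) =ᵐ[fieldMeasure P j (Matrix.specialUnitaryGroup (Fin 2) ℂ)] ρc)
    (hle : (fieldMeasure P j (Matrix.specialUnitaryGroup (Fin 2) ℂ)).withDensity (fun V => ENNReal.ofReal (ρc V)) ≤
      (fieldMeasure P j (Matrix.specialUnitaryGroup (Fin 2) ℂ)).withDensity (fun V => ENNReal.ofReal (ρt V)))
    (hdom : ∀ V, PlaqSmall prm.δ V → ρt V ≤ Real.exp Δ * ρc V) :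
    Mem av { prm with slack := prm.slack + Δ } (fun V => Real.exp κ * ρc V) := by
  haveI : BorelSpace (GaugeField P j (Matrix.specialUnitaryGroup (Fin 2) ℂ)) := T3OrbitAverage.instBorelSpaceGaugeField
  have hptw := density_le_of_withDensity_le hcc htc ht0 hle
  have hinv := gaugeInvariant_of_continuous_of_ae hcc hcinv
  refine mem_of_dominated hmem ((continuous_const.mul hcc).measurable) (fun g V => by show Real.exp κ * _ = Real.exp κ * _; rw [hinv g V])
    (fun V => mul_nonneg (Real.exp_nonneg _) (hc0 V)) (fun V => mul_le_mul_of_nonneg_left (hptw V) (Real.exp_nonneg _)) hΔ fun V hV => ?_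
  calc Real.exp κ * ρt V ≤ Real.exp κ * (Real.exp Δ * ρc V) := mul_le_mul_of_nonneg_left (hdom V hV) (Real.exp_nonneg _)
    _ = Real.exp Δ * (Real.exp κ * ρc V) := by ring

end Cut

/-! ## §5 Parameter side: enlarging the slack by a geometrically small amount keeps the schedule admissible -/

section Slack

/-- Two geometric bounds have a common geometric bound: `S₀qⁿ + S₁q₁ⁿ ≤ (max S₀ 0 + max S₁ 0)·(max q q₁)ⁿ`. [folklore] -/
theorem geom_add_le {S₀ S₁ q q₁ : ℝ} (hq : 0 ≤ q) (hq₁ : 0 ≤ q₁) (n : ℕ) :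
    S₀ * q ^ n + S₁ * q₁ ^ n ≤ (max S₀ 0 + max S₁ 0) * max q q₁ ^ n := by
  have h1 : S₀ * q ^ n ≤ max S₀ 0 * max q q₁ ^ n :=
    (mul_le_mul_of_nonneg_right (le_max_left _ _) (pow_nonneg hq n)).trans
      (mul_le_mul_of_nonneg_left (pow_le_pow_left₀ hq (le_max_left _ _) n) (le_max_right _ _))
  have h2 : S₁ * q₁ ^ n ≤ max S₁ 0 * max q q₁ ^ n :=
    (mul_le_mul_of_nonneg_right (le_max_left _ _) (pow_nonneg hq₁ n)).trans
      (mul_le_mul_of_nonneg_left (pow_le_pow_left₀ hq₁ (le_max_right _ _) n) (le_max_right _ _))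
  linarith

/-- ★★ **ADMISSIBILITY SURVIVES A GEOMETRICALLY SMALL SLACK ENLARGEMENT**: if `prm` is admissible and `0 ≤ Δ_j ≤ S₁·q₁^j` with `0 ≤ q₁ < 1`, then `j ↦ {prm j with slack := slack_j + Δ_j}`
is admissible. [cite: Balaban1985UV3, (41) p.266 and (47) p.267] -/
theorem admissible_add_slack (F : T3Family) {γ b₀ p₀ : ℝ} {prm : ℕ → ClassParams} (h : AdmissibleClassParams F γ b₀ p₀ prm)
    (Δ : ℕ → ℝ) {S₁ q₁ : ℝ} (hq₁0 : 0 ≤ q₁) (hq₁1 : q₁ < 1) (hΔ : ∀ j, Δ j ≤ S₁ * q₁ ^ j) :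
    AdmissibleClassParams F γ b₀ p₀ (fun j => { prm j with slack := (prm j).slack + Δ j }) := by
  obtain ⟨S₀, q, hq0, hq1, hslack⟩ := h.slack
  exact
    { window := h.window
      regular := h.regular
      largeThreshold := h.largeThreshold
      beta := h.beta
      decay := h.decay
      diam := h.diam
      cover := h.cover
      vacuum := h.vacuum
      slack := ⟨max S₀ 0 + max S₁ 0, max q q₁, le_max_of_le_left hq0, max_lt hq1 hq₁1, fun j =>
        (add_le_add (hslack j) (hΔ j)).trans (geom_add_le hq0 hq₁0 j)⟩
      largeField := h.largeField
      stability := h.stability }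

end Slack

end Summit.QuantumFields.YangMills.Theorems.FluctuationComparisonRegPrIntLS1aMemOfDominated

end
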